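import Mathlib
import Literature.Analysis.FluidPDE.ClassicalSolution
import Literature.Analysis.FluidPDE.KochTataruFixedPoint
import Summits.NavierStokesRegularity.NavierStokesRegularity.Theorems.LandauTailLandauTailBlowupDirichletLsc
import Summits.NavierStokesRegularity.NavierStokesRegularity.Theorems.LandauTailLandauTailBlowupGradientDyadic

/-!
# Enstrophy Type II at the parabolic core of a Landau-tailed blow-up

Helper file for crux `LandauTailBlowup` (stmt-NavierStokesRegularity-1944), line `registered`,
registered stubs `landauTail_core_enstrophy_tendsto_top` (B3, "enstrophy Type II at the parabolic
core") and `landauTail_core_dissipation_tendsto_top` (B3', Frobenius form).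

Setting.  `u` is a classical Navier–Stokes flow on the time interval `(-1, 0)` with a *Landau
tail* at the space–time origin: the self-similarly rescaled slices
`v_t (y) = √(-t) • u t (√(-t) • y)` converge pointwise on `y ≠ 0`, as `t → 0⁻`, to a profile `U`
which is smooth off the origin, `(−1)`-homogeneous and not identically zero.

Claim (B3).  For every core ratio `ρ > 0`,
`√(-t) ∫_{B(0, ρ√(-t))} ‖D(u t)‖² → ∞` as `t → 0⁻`.

Proof (folklore; Fatou).  By the chain rule `D v_t (y) = (-t) • D(u t)(√(-t) y)` and the dilation
`x = √(-t) y` (Jacobian `(-t)^{3/2}`), `∫_{B(0,ρ)} ‖D v_t‖² = √(-t) ∫_{B(0,ρ√(-t))} ‖D(u t)‖²`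
(`landauTail_coreEnstrophy_rescale`).  If the claim failed, some level `M` would bound the scaled
enstrophy along a sequence `t_k → 0⁻` in `(-1, 0)`, so `∫_{B(0,ρ)} ‖D v_k‖² ≤ M` for the slices
`v_k = v_{t_k}`, which converge pointwise off the origin to `U`.  The gradient of `U` has
infinite Dirichlet energy near `0`, witnessed on finitely many pairwise disjoint balls
`B(x_j, r_j) ⊂ B_ρ ∖ 0` with `Σ_j ∫_{B(x_j, δ_j)} ‖DU‖² > 3M + 1`
(`landauTail_profile_gradient_dyadic`), while lower semicontinuity of the local Dirichlet energy
under pointwise convergence (`landauTail_dirichlet_lsc`) gives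
`∫_{B(x_j,δ_j)} ‖DU‖² ≤ 3 liminf_k ∫_{B(x_j,r_j)} ‖Dv_k‖²`; summing over `j` (superadditivity of
`liminf`, disjointness of the balls) `3M + 1 < 3 liminf_k ∫_{B(0,ρ)} ‖Dv_k‖² ≤ 3M`, absurd.

B3' follows from B3 and `‖L‖² ≤ |L|²` (operator norm versus Frobenius norm,
`landauTail_dirichletLsc_sq_opNorm_le_sum` for the standard orthonormal basis).
-/

set_option linter.dupNamespace false

namespace Summit.NavierStokesRegularity.NavierStokesRegularity.Theorems

open MeasureTheory Set Filter Metric Topology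
open scoped ENNReal NNReal

/-- **Rescaling the local enstrophy** [folklore]: for `g : ℝ³ → ℝ³` differentiable and `s > 0`,
the slice `w ↦ s • g (s • w)` satisfies
`∫_{B(0,ρ)} ‖D(s • g (s • ·))‖ₑ² = s · ∫_{B(0,ρ s)} ‖Dg‖ₑ²`
(chain rule `D(s • g(s • ·))(y) = s² • Dg(s y)` and the dilation `x = s y`, Jacobian `s³`,
`landauTail_gradDyadic_setLIntegral_ball_smul`). -/
theorem landauTail_coreEnstrophy_rescale
    (g : EuclideanSpace ℝ (Fin 3) → EuclideanSpace ℝ (Fin 3)) (hg : Differentiable ℝ g)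
    {s : ℝ} (hs : 0 < s) (ρ : ℝ) :
    ∫⁻ y in ball (0 : EuclideanSpace ℝ (Fin 3)) ρ,
        ‖fderiv ℝ (fun w : EuclideanSpace ℝ (Fin 3) => s • g (s • w)) y‖ₑ ^ 2 =
      ENNReal.ofReal s * ∫⁻ x in ball (0 : EuclideanSpace ℝ (Fin 3)) (ρ * s),
        ‖fderiv ℝ g x‖ₑ ^ 2 := by
  have hder : ∀ y : EuclideanSpace ℝ (Fin 3),
      fderiv ℝ (fun w : EuclideanSpace ℝ (Fin 3) => s • g (s • w)) y =
        (s * s) • fderiv ℝ g (s • y) := by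
    intro y
    have h1 : HasFDerivAt (fun w : EuclideanSpace ℝ (Fin 3) => s • w)
        (s • ContinuousLinearMap.id ℝ (EuclideanSpace ℝ (Fin 3))) y :=
      (hasFDerivAt_id y).const_smul s
    have h2 : HasFDerivAt g (fderiv ℝ g (s • y)) (s • y) := (hg (s • y)).hasFDerivAt
    have h3 : HasFDerivAt (fun w : EuclideanSpace ℝ (Fin 3) => s • g (s • w))
        (s • ((fderiv ℝ g (s • y)).comp
          (s • ContinuousLinearMap.id ℝ (EuclideanSpace ℝ (Fin 3))))) y :=
      (h2.comp y h1).const_smul s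
    rw [h3.fderiv, ContinuousLinearMap.comp_smul, ContinuousLinearMap.comp_id, smul_smul]
  have hpt : ∀ y : EuclideanSpace ℝ (Fin 3),
      ‖fderiv ℝ (fun w : EuclideanSpace ℝ (Fin 3) => s • g (s • w)) y‖ₑ ^ 2 =
        ENNReal.ofReal ((s * s) ^ 2) * ‖fderiv ℝ g (s • y)‖ₑ ^ 2 := by
    intro y
    rw [hder, enorm_smul, mul_pow, Real.enorm_eq_ofReal (by positivity),
      ENNReal.ofReal_pow (by positivity)]
  have hball := landauTail_gradDyadic_setLIntegral_ball_smul
    (fun x => ‖fderiv ℝ g x‖ₑ ^ 2) hs 0 ρ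
  rw [smul_zero, mul_comm s ρ] at hball
  calc ∫⁻ y in ball (0 : EuclideanSpace ℝ (Fin 3)) ρ,
        ‖fderiv ℝ (fun w : EuclideanSpace ℝ (Fin 3) => s • g (s • w)) y‖ₑ ^ 2
      = ∫⁻ y in ball (0 : EuclideanSpace ℝ (Fin 3)) ρ,
          ENNReal.ofReal ((s * s) ^ 2) * ‖fderiv ℝ g (s • y)‖ₑ ^ 2 :=
        lintegral_congr fun y => hpt y
    _ = ENNReal.ofReal ((s * s) ^ 2) *
          ∫⁻ y in ball (0 : EuclideanSpace ℝ (Fin 3)) ρ, ‖fderiv ℝ g (s • y)‖ₑ ^ 2 :=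
        lintegral_const_mul' _ _ ENNReal.ofReal_ne_top
    _ = ENNReal.ofReal s * ∫⁻ x in ball (0 : EuclideanSpace ℝ (Fin 3)) (ρ * s),
          ‖fderiv ℝ g x‖ₑ ^ 2 := by
        rw [hball, ← mul_assoc, ← ENNReal.ofReal_mul hs.le,
          show (s * s) ^ 2 = s * s ^ 3 by ring]

/-- **Superadditivity of `liminf` over a finite sum** [folklore]: for sequences in `ℝ≥0∞`,
`Σ_{j ∈ s} liminf_k a_j(k) ≤ liminf_k Σ_{j ∈ s} a_j(k)` (induction on `s` from the two-term case
`Literature.Analysis.FluidPDE.liminf_add_liminf_le_liminf_add`). -/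
theorem landauTail_coreEnstrophy_sum_liminf_le {ι : Type*} (s : Finset ι) (a : ι → ℕ → ℝ≥0∞) :
    ∑ j ∈ s, liminf (a j) atTop ≤ liminf (fun k => ∑ j ∈ s, a j k) atTop := by
  classical
  induction s using Finset.induction_on with
  | empty => simp
  | insert j s hj ih =>
    simp only [Finset.sum_insert hj]
    exact (add_le_add le_rfl ih).trans
      (Literature.Analysis.FluidPDE.liminf_add_liminf_le_liminf_add (a j) fun k => ∑ i ∈ s, a i k)

/-- **B3 — enstrophy Type II at the parabolic core** [folklore; Fatou] (registered stub B3 of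
crux `LandauTailBlowup`, stmt-NavierStokesRegularity-1944, theorem H2).  Let `(u, p)` be a
classical Navier–Stokes flow on `(-1, 0) × ℝ³` with a Landau tail at the origin:
`√(-t) • u t (√(-t) • y) → U y` as `t → 0⁻` for every `y ≠ 0`, the profile `U` being smooth off
`0`, `(−1)`-homogeneous and not identically zero.  Then for every core ratio `ρ > 0` the scaled
enstrophy of the parabolic core diverges: `√(-t) ∫_{B(0, ρ√(-t))} ‖D(u t)‖ₑ² → ∞` as `t → 0⁻`.
Proof: the rescaled slices `v_k (y) = √(-t_k) u(t_k, √(-t_k) y)` along any sequence `t_k → 0⁻`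
converge pointwise off `0` to `U` and carry exactly the scaled enstrophy
(`landauTail_coreEnstrophy_rescale`); a bound `M` along the sequence would give, by lower
semicontinuity on each of the disjoint balls of `landauTail_profile_gradient_dyadic`
(`landauTail_dirichlet_lsc`) and superadditivity of `liminf`,
`3M + 1 < Σ_j ∫_{B(x_j,δ_j)} ‖DU‖² ≤ 3 liminf_k ∫_{B(0,ρ)} ‖Dv_k‖² ≤ 3M`. -/
theorem landauTail_core_enstrophy_tendsto_top : ∀ (u : ℝ → EuclideanSpace ℝ (Fin 3) → EuclideanSpace ℝ (Fin 3)) (p : ℝ → EuclideanSpace ℝ (Fin 3) → ℝ) (U : EuclideanSpace ℝ (Fin 3) → EuclideanSpace ℝ (Fin 3)) (P : EuclideanSpace ℝ (Fin 3) → ℝ), (ContDiffOn ℝ (⊤ : ℕ∞) U {0}ᶜ ∧ ContDiffOn ℝ (⊤ : ℕ∞) P {0}ᶜ ∧ (∀ x : EuclideanSpace ℝ (Fin 3), x ≠ 0 → Literature.Analysis.FluidPDE.convect U U x + gradient P x = (1 : ℝ) • Laplacian.laplacian U x) ∧ (∀ x : EuclideanSpace ℝ (Fin 3), x ≠ 0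 → Literature.Analysis.FluidPDE.VectorCalculus.divergence U x = 0) ∧ (∀ c : ℝ, 0 < c → ∀ x : EuclideanSpace ℝ (Fin 3), U (c • x) = c⁻¹ • U x) ∧ (∃ x : EuclideanSpace ℝ (Fin 3), U x ≠ 0)) → Literature.Analysis.FluidPDE.IsClassicalNSSolutionOn (Set.Ioo (-1) 0) 1 0 u p → (∀ y : EuclideanSpace ℝ (Fin 3), y ≠ 0 → Filter.Tendsto (fun t : ℝ => Real.sqrt (0 - t) • u t (Real.sqrt (0 - t) • y)) (nhdsWithin 0 (Set.Iio 0)) (nhds (U y))) → ∀ ρ : ℝ, 0 < ρ → Filter.Tendsto (fun t : ℝ => ENNReal.ofReal (Real.sqrt (-t)) * ∫⁻ x in Metric.ball (0 : EuclideanSpace ℝ (Fin 3)) (ρ * Real.sqrt (-t)), ‖fderiv ℝ (u t) x‖ₑ ^ 2) (nhdsWithin 0 (Set.Iio 0)) (nhds ⊤) := by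
  intro u p U P hprof hcl htail ρ hρ
  obtain ⟨hUs, -, -, -, hhom, hne⟩ := hprof
  have hU1 : ContDiffOn ℝ 1 U {0}ᶜ := hUs.of_le (mod_cast le_top)
  -- the tail, with `0 - t` simplified to `-t`
  have htail' : ∀ y : EuclideanSpace ℝ (Fin 3), y ≠ 0 → Tendsto
      (fun t : ℝ => Real.sqrt (-t) • u t (Real.sqrt (-t) • y)) (𝓝[<] 0) (𝓝 (U y)) := by
    intro y hy
    simpa only [zero_sub] using htail y hy
  rw [ENNReal.tendsto_nhds_top_iff_nnreal]
  intro M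
  by_contra H
  -- a sequence of times `t_k → 0⁻` in `(-1, 0)` along which the scaled enstrophy is `≤ M`
  have hfr := (not_eventually.1 H).and_eventually (Ioo_mem_nhdsLT (show (-1 : ℝ) < 0 by norm_num))
  obtain ⟨tk, htk, hk⟩ := exists_seq_forall_of_frequently hfr
  have ht0 : ∀ k, 0 < -tk k := fun k => neg_pos.2 (hk k).2.2
  have hsk : ∀ k, 0 < Real.sqrt (-tk k) := fun k => Real.sqrt_pos.2 (ht0 k)
  -- the rescaled slices `v k (y) = √(-t_k) • u (t_k) (√(-t_k) • y)`
  obtain ⟨v, hv⟩ : ∃ v : ℕ → EuclideanSpace ℝ (Fin 3) → EuclideanSpace ℝ (Fin 3),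
      ∀ k, v k = fun y => Real.sqrt (-tk k) • u (tk k) (Real.sqrt (-tk k) • y) :=
    ⟨_, fun _ => rfl⟩
  have hu : ∀ k, ContDiff ℝ 1 (u (tk k)) := fun k =>
    (hcl.contDiff_velocity (hk k).2).of_le (mod_cast le_top)
  have hvC : ∀ k, ContDiff ℝ 1 (v k) := fun k => by
    rw [hv k]
    exact ((hu k).comp (contDiff_const_smul _)).const_smul _
  have hvlim : ∀ y : EuclideanSpace ℝ (Fin 3), y ≠ 0 →
      Tendsto (fun k => v k y) atTop (𝓝 (U y)) := by
    intro y hy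
    refine ((htail' y hy).comp htk).congr fun k => ?_
    simp only [Function.comp_apply, hv k]
  -- the enstrophy of `v k` on `ball 0 ρ` is the scaled enstrophy of `u (t_k)`, hence `≤ M`
  have hbound : ∀ k, ∫⁻ y in ball (0 : EuclideanSpace ℝ (Fin 3)) ρ,
      ‖fderiv ℝ (v k) y‖ₑ ^ 2 ≤ M := by
    intro k
    rw [hv k, landauTail_coreEnstrophy_rescale (u (tk k)) ((hu k).differentiable one_ne_zero)
      (hsk k) ρ]
    exact not_lt.1 (hk k).1
  have hlim : liminf (fun k => ∫⁻ y in ball (0 : EuclideanSpace ℝ (Fin 3)) ρ,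
      ‖fderiv ℝ (v k) y‖ₑ ^ 2) atTop ≤ M :=
    liminf_le_of_frequently_le' (Frequently.of_forall hbound)
  -- disjoint balls near the origin carrying more than `3M + 1` of the energy of `DU`
  obtain ⟨J, x, δ, r, hδr, hsub, hdisj, hM⟩ :=
    landauTail_profile_gradient_dyadic U hU1 hhom hne ρ hρ (3 * M + 1)
  have hball0 : ∀ j, ball (x j) (r j) ⊆ {0}ᶜ := fun j y hy =>
    (hsub j (ball_subset_closedBall hy)).2
  -- lower semicontinuity of the Dirichlet energy on each ball
  have hlsc : ∀ j, ∫⁻ y in ball (x j) (δ j), ‖fderiv ℝ U y‖ₑ ^ 2 ≤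
      3 * liminf (fun k => ∫⁻ y in ball (x j) (r j), ‖fderiv ℝ (v k) y‖ₑ ^ 2) atTop := by
    intro j
    have hr : δ j + (r j - δ j) = r j := add_sub_cancel (δ j) (r j)
    have h := landauTail_dirichlet_lsc v U (x j) (δ j) (r j - δ j) (hδr j).1
      (sub_pos.2 (hδr j).2) hvC (by rw [hr]; exact hU1.mono (hball0 j))
      (by rw [hr]; exact fun y hy => hvlim y (mem_compl_singleton_iff.1 (hball0 j hy)))
    rwa [hr] at h
  -- for each `k` the disjoint balls carry at most the enstrophy of `v k` on `ball 0 ρ`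
  have hsum : ∀ k, ∑ j, ∫⁻ y in ball (x j) (r j), ‖fderiv ℝ (v k) y‖ₑ ^ 2 ≤
      ∫⁻ y in ball (0 : EuclideanSpace ℝ (Fin 3)) ρ, ‖fderiv ℝ (v k) y‖ₑ ^ 2 := by
    intro k
    calc ∑ j, ∫⁻ y in ball (x j) (r j), ‖fderiv ℝ (v k) y‖ₑ ^ 2
        = ∑' j, ∫⁻ y in ball (x j) (r j), ‖fderiv ℝ (v k) y‖ₑ ^ 2 := (tsum_fintype _).symm
      _ = ∫⁻ y in ⋃ j, ball (x j) (r j), ‖fderiv ℝ (v k) y‖ₑ ^ 2 :=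
          (lintegral_iUnion (fun j => measurableSet_ball) hdisj _).symm
      _ ≤ ∫⁻ y in ball (0 : EuclideanSpace ℝ (Fin 3)) ρ, ‖fderiv ℝ (v k) y‖ₑ ^ 2 :=
          lintegral_mono_set (iUnion_subset fun j =>
            ball_subset_closedBall.trans ((hsub j).trans Set.sdiff_subset))
  -- summing the lower semicontinuity over the balls contradicts the bound `M`
  have key : ((3 * M + 1 : ℝ≥0) : ℝ≥0∞) ≤ 3 * (M : ℝ≥0∞) :=
    calc ((3 * M + 1 : ℝ≥0) : ℝ≥0∞)
        ≤ ∑ j, ∫⁻ y in ball (x j) (δ j), ‖fderiv ℝ U y‖ₑ ^ 2 := hM.le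
      _ ≤ ∑ j, 3 * liminf (fun k => ∫⁻ y in ball (x j) (r j), ‖fderiv ℝ (v k) y‖ₑ ^ 2) atTop :=
          Finset.sum_le_sum fun j _ => hlsc j
      _ = 3 * ∑ j, liminf (fun k => ∫⁻ y in ball (x j) (r j), ‖fderiv ℝ (v k) y‖ₑ ^ 2) atTop := by
          rw [Finset.mul_sum]
      _ ≤ 3 * liminf (fun k => ∑ j, ∫⁻ y in ball (x j) (r j), ‖fderiv ℝ (v k) y‖ₑ ^ 2) atTop :=
          mul_le_mul_right (landauTail_coreEnstrophy_sum_liminf_le Finset.univ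
            fun j k => ∫⁻ y in ball (x j) (r j), ‖fderiv ℝ (v k) y‖ₑ ^ 2) 3
      _ ≤ 3 * liminf (fun k => ∫⁻ y in ball (0 : EuclideanSpace ℝ (Fin 3)) ρ,
            ‖fderiv ℝ (v k) y‖ₑ ^ 2) atTop :=
          mul_le_mul_right (liminf_le_liminf (Eventually.of_forall hsum)) 3
      _ ≤ 3 * M := mul_le_mul_right hlim 3
  have key' : 3 * M + 1 ≤ 3 * M := by exact_mod_cast key
  exact absurd key' (not_le.2 (lt_add_one (3 * M)))

/-- **B3' — enstrophy Type II at the parabolic core, Frobenius (dissipation-density) form**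
[folklore] (registered stub B3' of crux `LandauTailBlowup`, stmt-NavierStokesRegularity-1944):
under the hypotheses of `landauTail_core_enstrophy_tendsto_top`, for every `ρ > 0`,
`√(-t) ∫_{B(0, ρ√(-t))} |∇u(t)|² → ∞` as `t → 0⁻`, with the dissipation density
`|∇u|² = frobeniusNormSq (Du)`.  Immediate from B3 and the pointwise bound `‖Du‖ₑ² ≤ |∇u|²`
(operator norm versus Frobenius norm, `landauTail_dirichletLsc_sq_opNorm_le_sum` in the standard
orthonormal basis). -/
theorem landauTail_core_dissipation_tendsto_top : ∀ (u : ℝ → EuclideanSpace ℝ (Fin 3) → EuclideanSpace ℝ (Fin 3)) (p : ℝ → EuclideanSpace ℝ (Fin 3) → ℝ) (U : EuclideanSpace ℝ (Fin 3) → EuclideanSpace ℝ (Fin 3)) (P : EuclideanSpace ℝ (Fin 3) → ℝ), (ContDiffOn ℝ (⊤ : ℕ∞) U {0}ᶜ ∧ ContDiffOn ℝ (⊤ : ℕ∞) P {0}ᶜ ∧ (∀ x : EuclideanSpace ℝ (Fin 3), x ≠ 0 → Literature.Analysis.FluidPDE.convect U U x + gradient P x = (1 : ℝ) • Laplacian.laplacian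 U x) ∧ (∀ x : EuclideanSpace ℝ (Fin 3), x ≠ 0 → Literature.Analysis.FluidPDE.VectorCalculus.divergence U x = 0) ∧ (∀ c : ℝ, 0 < c → ∀ x : EuclideanSpace ℝ (Fin 3), U (c • x) = c⁻¹ • U x) ∧ (∃ x : EuclideanSpace ℝ (Fin 3), U x ≠ 0)) → Literature.Analysis.FluidPDE.IsClassicalNSSolutionOn (Set.Ioo (-1) 0) 1 0 u p → (∀ y : EuclideanSpace ℝ (Fin 3), y ≠ 0 → Filter.Tendsto (fun t : ℝ => Real.sqrt (0 - t) • u t (Real.sqrt (0 - t) • y)) (nhdsWithin 0 (Set.Iio 0)) (nhds (U y))) → ∀ ρ : ℝ, 0 < ρ → Filter.Tendsto (fun t : ℝ => ENNReal.ofReal (Real.sqrt (-t)) * ∫⁻ x in Metric.ball (0 : EuclideanSpace ℝ (Fin 3)) (ρ * Real.sqrt (-t)), ENNReal.ofReal (Literature.Analysis.FluidPDE.frobeniusNormSq (fderiv ℝ (u t) x))) (nhdsWithin 0 (Set.Iio 0)) (nhds ⊤) := by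
  intro u p U P hprof hcl htail ρ hρ
  -- pointwise: `‖L‖ₑ² ≤ |L|²` for the Frobenius norm in the standard orthonormal basis
  have hpt : ∀ L : EuclideanSpace ℝ (Fin 3) →L[ℝ] EuclideanSpace ℝ (Fin 3),
      ‖L‖ₑ ^ 2 ≤ ENNReal.ofReal (Literature.Analysis.FluidPDE.frobeniusNormSq L) := by
    intro L
    calc ‖L‖ₑ ^ 2 = ENNReal.ofReal (‖L‖ ^ 2) := by
          rw [ENNReal.ofReal_pow (norm_nonneg _), ofReal_norm]
      _ ≤ ENNReal.ofReal (Literature.Analysis.FluidPDE.frobeniusNormSq L) :=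
          ENNReal.ofReal_le_ofReal (landauTail_dirichletLsc_sq_opNorm_le_sum
            (stdOrthonormalBasis ℝ (EuclideanSpace ℝ (Fin 3))) L)
  exact tendsto_nhds_top_mono
    (landauTail_core_enstrophy_tendsto_top u p U P hprof hcl htail ρ hρ)
    (Eventually.of_forall fun t =>
      mul_le_mul_right (lintegral_mono fun x => hpt (fderiv ℝ (u t) x)) _)

end Summit.NavierStokesRegularity.NavierStokesRegularity.Theorems
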